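import Mathlib.MeasureTheory.Integral.Lebesgue.Basic
import Mathlib.MeasureTheory.Measure.Lebesgue.Basic
import Mathlib.Analysis.Normed.Group.Basic
import Mathlib.Topology.Order.Compact
import HarnessLib

/-!
# Conformal removability: the partition argument on a line (Jones–Smirnov 2000, Prop. 1)

P. W. Jones, S. K. Smirnov, *Removability theorems for Sobolev functions and quasiconformal maps*,
Ark. Mat. 38 (2000) 263–279, proof of Prop. 1, pp. 270–271: "Fix one interval `[xⱼ, yⱼ]`. Since
there are only finitely many cubes of the size `Δ`, and the set `[xⱼ, yⱼ] ∩ K` is covered by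
their shadows (which are compact sets), one can cut `[xⱼ, yⱼ]` into finitely many intervals
`[uᵢ, uᵢ₊₁]` so that `u₀ = xⱼ` and `uₙ = yⱼ`. By an easy compactness argument this can be done in
such a way, that for every `i` either `(uᵢ, uᵢ₊₁) ⊆ Kᶜ` or `uᵢ` and `uᵢ₊₁` belong to the same
shadow … In the first case we just write `|f(uᵢ) - f(uᵢ₊₁)| ≤ ∫_{[uᵢ,uᵢ₊₁]} |∂f|`. In the latter
case …" followed by adding up the estimates.

We isolate this "easy compactness argument" as an abstract real-variable lemma,
`enorm_sub_le_lintegral_add_sum`, in the form in which the estimates are added up directly: let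
`Kl ⊆ (-∞, u']` be closed with `u' ∈ Kl` (the slice of `K`), covered from `u` on by finitely many
closed sets `A i`, `i ∈ I` (the shadows of the hubs), on each of which `f` oscillates by at most
`C i`, and suppose `‖f b - f a‖ ≤ ∫_{(a,b]} g` whenever `a ≤ b` are points of `Kl` with
`(a, b) ∩ Kl = ∅` (the gaps). Then `‖f u' - f u‖ ≤ ∫_{(u,u']} g + Σ_{i ∈ I} C i` for every
`u ∈ Kl`. The proof is an induction on the number of sets: from `u ∈ A j` jump to the last point
`b` of `A j ∩ Kl`; then either the next point `c = inf (Kl ∩ (b, u'])` of `Kl` is `> b` — a gap —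
and `Kl ∩ [c, u']` is covered by the `A i`, `i ≠ j`, or `c = b` and already `Kl ∩ [b, u']` is
covered by them (a finite union of closed sets is closed).
-/

noncomputable section

open Set MeasureTheory Filter

open scoped ENNReal NNReal Topology

namespace Literature.Probability.RandomPlanarGeometry

/-- **The partition estimate on a line** (Jones–Smirnov 2000, proof of Prop. 1, pp. 270–271,
abstract form). `Kl` closed, bounded above by `u' ∈ Kl`; closed sets `A i` with
`‖f t - f s‖ₑ ≤ C i` for `s, t ∈ A i`; the gap estimate `‖f b - f a‖ₑ ≤ ∫⁻_{(a,b]} g` for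
`a ≤ b` in `Kl` with no point of `Kl` strictly between them. If the points of `Kl` to the right
of `u ∈ Kl` are covered by the `A i`, `i ∈ I`, then
`‖f u' - f u‖ₑ ≤ ∫⁻_{(u,u']} g + Σ_{i ∈ I} C i`. [cite: JonesSmirnov2000, proof of Prop. 1, pp. 270–271] -/
theorem enorm_sub_le_lintegral_add_sum {E : Type*} [NormedAddCommGroup E] {ι : Type*}
    {f : ℝ → E} {g : ℝ → ℝ≥0∞} {Kl : Set ℝ} (hKl : IsClosed Kl) {u' : ℝ} (hu' : u' ∈ Kl)
    (hKu' : ∀ t ∈ Kl, t ≤ u') {A : ι → Set ℝ} (hA : ∀ i, IsClosed (A i)) {C : ι → ℝ≥0∞}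
    (hC : ∀ i, ∀ s ∈ A i, ∀ t ∈ A i, ‖f t - f s‖ₑ ≤ C i)
    (hgap : ∀ a b, a ≤ b → a ∈ Kl → b ∈ Kl → (∀ t ∈ Ioo a b, t ∉ Kl) →
      ‖f b - f a‖ₑ ≤ ∫⁻ t in Ioc a b, g t)
    (I : Finset ι) {u : ℝ} (hu : u ∈ Kl) (hcov : ∀ t ∈ Kl, u ≤ t → ∃ i ∈ I, t ∈ A i) :
    ‖f u' - f u‖ₑ ≤ (∫⁻ t in Ioc u u', g t) + ∑ i ∈ I, C i := by
  classical
  have htri : ∀ x y z : ℝ, ‖f x - f z‖ₑ ≤ ‖f x - f y‖ₑ + ‖f y - f z‖ₑ := fun x y z => by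
    have := edist_triangle (f x) (f y) (f z)
    simpa only [edist_eq_enorm_sub] using this
  refine Finset.strongInduction (p := fun I => ∀ u, u ∈ Kl → (∀ t ∈ Kl, u ≤ t → ∃ i ∈ I, t ∈ A i) →
    ‖f u' - f u‖ₑ ≤ (∫⁻ t in Ioc u u', g t) + ∑ i ∈ I, C i) (fun I ih => ?_) I u hu hcov
  intro u hu hcov
  have huu' : u ≤ u' := hKu' u hu
  obtain ⟨j, hj, huj⟩ := hcov u hu le_rfl
  -- the last point of `A j ∩ Kl` in `[u, u']`
  set B : Set ℝ := A j ∩ Kl ∩ Icc u u' with hB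
  have hBc : IsCompact B :=
    isCompact_Icc.of_isClosed_subset (((hA j).inter hKl).inter isClosed_Icc) inter_subset_right
  have hBne : B.Nonempty := ⟨u, ⟨huj, hu⟩, left_mem_Icc.2 huu'⟩
  set b := sSup B with hb
  have hBle : ∀ t ∈ B, t ≤ b := fun t ht => le_csSup hBc.bddAbove ht
  obtain ⟨⟨hbA, hbK⟩, hub, hbu'⟩ := hBc.sSup_mem hBne
  have e1 : ‖f b - f u‖ₑ ≤ C j := hC j u huj b hbA
  have hCj : C j ≤ ∑ i ∈ I, C i := Finset.single_le_sum (f := C) (fun i _ => bot_le) hj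
  -- the points of `Kl` beyond `b` are covered by the other sets
  have hcov' : ∀ t ∈ Kl, b < t → ∃ i ∈ I.erase j, t ∈ A i := by
    intro t ht hbt
    obtain ⟨i, hi, hti⟩ := hcov t ht (hub.trans hbt.le)
    refine ⟨i, Finset.mem_erase.2 ⟨?_, hi⟩, hti⟩
    rintro rfl
    have := hBle t ⟨⟨hti, ht⟩, hub.trans hbt.le, hKu' t ht⟩
    exact absurd this (not_le.2 hbt)
  have hJ : I.erase j ⊂ I := Finset.erase_ssubset hj
  rcases eq_or_lt_of_le hbu' with hbu | hbu
  · -- `b = u'`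
    rw [← hbu]
    exact e1.trans (hCj.trans le_add_self)
  · -- the next point `c` of `Kl` after `b`
    set T : Set ℝ := Kl ∩ Ioc b u' with hT
    have hTne : T.Nonempty := ⟨u', hu', hbu, le_rfl⟩
    have hTbdd : BddBelow T := ⟨b, fun t ht => ht.2.1.le⟩
    set c := sInf T with hc
    have hbc : b ≤ c := le_csInf hTne fun t ht => ht.2.1.le
    have hcu' : c ≤ u' := csInf_le hTbdd ⟨hu', hbu, le_rfl⟩
    have hc_cl : c ∈ closure T := csInf_mem_closure hTne hTbdd
    have hcK : c ∈ Kl := (closure_minimal inter_subset_left hKl) hc_cl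
    have hTc : ∀ t ∈ Kl, b < t → t ≤ u' → c ≤ t := fun t ht hbt htu =>
      csInf_le hTbdd ⟨ht, hbt, htu⟩
    rcases eq_or_lt_of_le hbc with hbc' | hbc'
    · -- `c = b`: `b` is in the closure of the points beyond it, hence in another `A i`
      have hsub : T ⊆ ⋃ i ∈ I.erase j, A i := fun t ht => by
        obtain ⟨i, hi, hti⟩ := hcov' t ht.1 ht.2.1
        exact mem_iUnion₂.2 ⟨i, hi, hti⟩
      have hcl : closure T ⊆ ⋃ i ∈ I.erase j, A i :=
        closure_minimal hsub (isClosed_biUnion_finset fun i _ => hA i)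
      have hbcov : ∀ t ∈ Kl, b ≤ t → ∃ i ∈ I.erase j, t ∈ A i := by
        intro t ht hbt
        rcases eq_or_lt_of_le hbt with hbt' | hbt'
        · have hb_cl : b ∈ closure T := by rw [hbc']; exact hc_cl
          obtain ⟨i, hi, hti⟩ := mem_iUnion₂.1 (hcl hb_cl)
          exact ⟨i, hi, hbt' ▸ hti⟩
        · exact hcov' t ht hbt'
      have e2 := ih (I.erase j) hJ b hbK hbcov
      calc ‖f u' - f u‖ₑ ≤ ‖f u' - f b‖ₑ + ‖f b - f u‖ₑ := htri _ _ _
        _ ≤ ((∫⁻ t in Ioc b u', g t) + ∑ i ∈ I.erase j, C i) + C j := add_le_add e2 e1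
        _ = (∫⁻ t in Ioc b u', g t) + ∑ i ∈ I, C i := by
            rw [add_assoc, Finset.sum_erase_add _ _ hj]
        _ ≤ (∫⁻ t in Ioc u u', g t) + ∑ i ∈ I, C i := by
            gcongr
    · -- `b < c`: the gap `(b, c)` contains no point of `Kl`
      have hgapbc : ∀ t ∈ Ioo b c, t ∉ Kl := fun t ht htK =>
        absurd (hTc t htK ht.1 (ht.2.le.trans hcu')) (not_le.2 ht.2)
      have e2 : ‖f c - f b‖ₑ ≤ ∫⁻ t in Ioc b c, g t := hgap b c hbc hbK hcK hgapbc
      have hccov : ∀ t ∈ Kl, c ≤ t → ∃ i ∈ I.erase j, t ∈ A i := fun t ht hct =>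
        hcov' t ht (hbc'.trans_le hct)
      have e3 := ih (I.erase j) hJ c hcK hccov
      have hunion : (∫⁻ t in Ioc b c, g t) + ∫⁻ t in Ioc c u', g t = ∫⁻ t in Ioc b u', g t := by
        rw [← lintegral_union measurableSet_Ioc (Ioc_disjoint_Ioc_of_le le_rfl),
          Ioc_union_Ioc_eq_Ioc hbc hcu']
      calc ‖f u' - f u‖ₑ ≤ ‖f u' - f c‖ₑ + ‖f c - f u‖ₑ := htri _ _ _
        _ ≤ ‖f u' - f c‖ₑ + (‖f c - f b‖ₑ + ‖f b - f u‖ₑ) := add_le_add le_rfl (htri _ _ _)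
        _ ≤ ((∫⁻ t in Ioc c u', g t) + ∑ i ∈ I.erase j, C i) +
            ((∫⁻ t in Ioc b c, g t) + C j) := add_le_add e3 (add_le_add e2 e1)
        _ = (∫⁻ t in Ioc b u', g t) + ∑ i ∈ I, C i := by
            rw [← Finset.sum_erase_add _ _ hj, ← hunion]
            ring
        _ ≤ (∫⁻ t in Ioc u u', g t) + ∑ i ∈ I, C i := by
            gcongr

end Literature.Probability.RandomPlanarGeometry
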